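import Mathlib
import Literature.Geometry.Symplectic.StandardEnd
import Literature.Geometry.Symplectic.GromovR4RelEndProofs
import Literature.Geometry.Symplectic.JHolomorphicMap
import Literature.NumberTheory.Transcendental.FormIntegrationCharts
import Summits.SmoothPoincare4.SmoothPoincare4.Theorems.SymplecticOrigamiGromovRecognitionRelEndStubFlatCutoffAux

/-!
# Forms toolkit for stub `stub_gluing` of line `Sketch`, crux `TameOrBrodyR4` (stmt-SmoothPoincare4-7826)

Helper file (first half) for the asymptotic pull-back gluing
(`SullivanDualTameOrBrodyR4StubGluing.lean`): the standard complex structure `J₀` of `ℝ⁴ = ℂ²`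
(`⟪J₀ a, b⟫ = ω₀(a, b)`, `ω₀(v, J₀v) = ‖v‖²`, `|ω₀(a, b)| ≤ ‖a‖‖b‖`), the Liouville `1`-form
`λ₀(x) = ½ ω₀(x, ·)` with `dλ₀ = ω₀` (Mathlib's `extDeriv`), its pull-back `Φ^*λ₀` with
`d(Φ^*λ₀) = Φ^*ω₀` (Mathlib's `extDeriv_pullback`), the product and difference rules for `d` on
`1`-forms evaluated on two vectors, smoothness of `extDeriv`, and the radial cut-off
`χ_ρ(x) = ψ((‖x‖²/ρ² - 1)/3)`, `ψ = Real.smoothTransition`, with its gradient bound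
`|dχ_ρ(x) v| ≤ (4K/3ρ)‖v‖` on the annulus `ρ ≤ ‖x‖ ≤ 2ρ` (`K = sup_[0,1]|ψ'|`).

The definitions here (`J0`, `oneForm`, `liouvilleCLM`, `liouville`, `pullLiouville`, `cutArg`,
`cutoff`, namespace `…Cruxes.TameOrBrodyR4.Sketch.Gluing`) are proof-internal gadgets of the
gluing step, not objects posited by route SullivanDual. References: McDuff–Salamon,
*Introduction to Symplectic Topology* (3rd ed. 2017), §1.1, (1.1.20)–(1.1.21) (`ω₀`, `J₀`, `λ₀`).
-/

noncomputable section

open scoped ContDiff Topology InnerProductSpace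
open Filter Set Metric Literature.Geometry.Symplectic
open Literature.NumberTheory.Transcendental (ContDiffAt.continuousAlternatingMapCompContinuousLinearMap)
open Summit.SmoothPoincare4.SmoothPoincare4.Theorems.GromovRecognitionRelEnd.CrossCapLaurent.FlatCutoff
  (abs_stdSymplecticForm_le)

-- the registered namespace `Summit.SmoothPoincare4.SmoothPoincare4.Theorems` repeats a component
set_option linter.dupNamespace false

namespace Summit.SmoothPoincare4.SmoothPoincare4.Cruxes.TameOrBrodyR4.Sketch.Gluing

/-- Local notation for the model space `ℝ⁴ = EuclideanSpace ℝ (Fin 4)`. -/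
local notation "E4" => EuclideanSpace ℝ (Fin 4)

/-! ### Linear algebra of `ω₀` and the standard complex structure `J₀` -/

/-- The standard complex structure `J₀ a = (-a₁, a₀, -a₃, a₂)` of `ℝ⁴ = ℂ²`, characterised by
`⟪J₀ a, b⟫ = ω₀(a, b)`. -/
def J0 : E4 →L[ℝ] E4 :=
  LinearMap.toContinuousLinearMap
    { toFun := fun a => WithLp.toLp 2 ![-a 1, a 0, -a 3, a 2]
      map_add' := by
        intro a b; ext i; fin_cases i <;> simp <;> ring
      map_smul' := by
        intro c a; ext i; fin_cases i <;> simp }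

/-- The defining formula of `J₀`. -/
theorem J0_apply (a : E4) : J0 a = WithLp.toLp 2 ![-a 1, a 0, -a 3, a 2] := rfl

/-- `⟪J₀ a, b⟫ = ω₀(a, b)`. -/
theorem inner_J0 (a b : E4) : ⟪J0 a, b⟫_ℝ = stdSymplecticForm a b := by
  rw [J0_apply, PiLp.inner_apply, Fin.sum_univ_four]
  simp [stdSymplecticForm]
  ring

/-- `‖J₀ a‖ = ‖a‖`. -/
theorem norm_J0 (a : E4) : ‖J0 a‖ = ‖a‖ := by
  have h : ‖J0 a‖ ^ 2 = ‖a‖ ^ 2 := by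
    rw [EuclideanSpace.real_norm_sq_eq, EuclideanSpace.real_norm_sq_eq, Fin.sum_univ_four,
      Fin.sum_univ_four, J0_apply]
    simp
    ring
  have h1 : 0 ≤ ‖J0 a‖ := norm_nonneg _
  have h2 : 0 ≤ ‖a‖ := norm_nonneg _
  nlinarith [h, h1, h2, sq_nonneg (‖J0 a‖ - ‖a‖), sq_nonneg (‖J0 a‖ + ‖a‖)]

/-- `ω₀(v, J₀ v) = ‖v‖²`. -/
theorem stdSymplecticForm_J0 (v : E4) : stdSymplecticForm v (J0 v) = ‖v‖ ^ 2 := by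
  rw [J0_apply]; exact stdSymplecticForm_rot_eq_norm_sq v

/-- A structure that is standard (`⟪J a, b⟫ = ω₀(a, b)`) at a point equals `J₀` there. -/
theorem eq_J0_of_inner_eq {Jx : E4 →L[ℝ] E4}
    (h : ∀ a b : E4, ⟪Jx a, b⟫_ℝ = stdSymplecticForm a b) : Jx = J0 := by
  ext1 a
  refine ext_inner_right ℝ fun b => ?_
  rw [h a b, inner_J0]


/-! ### One-forms and two-forms on `ℝ⁴`: the Liouville form and `dλ₀ = ω₀` -/

/-- A `1`-form value from a continuous linear functional (`Fin 1`-alternating maps). -/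
def oneForm : (E4 →L[ℝ] ℝ) →L[ℝ] (E4 [⋀^Fin 1]→L[ℝ] ℝ) :=
  ((ContinuousAlternatingMap.ofSubsingletonLIE (𝕜 := ℝ) (E := E4) (F := ℝ)
      (0 : Fin 1)).toContinuousLinearEquiv : (E4 →L[ℝ] ℝ) →L[ℝ] (E4 [⋀^Fin 1]→L[ℝ] ℝ))

/-- `oneForm f v = f (v 0)`. -/
@[simp] theorem oneForm_apply (f : E4 →L[ℝ] ℝ) (v : Fin 1 → E4) : oneForm f v = f (v 0) := by
  simp [oneForm]

/-- The Liouville form `λ₀(x)(w) = ½ ω₀(x, w)` as a continuous linear map in `x`. -/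
def liouvilleCLM : E4 →L[ℝ] (E4 [⋀^Fin 1]→L[ℝ] ℝ) :=
  oneForm.comp ((1 / 2 : ℝ) • stdSymplecticBilin)

/-- The Liouville `1`-form `λ₀` on `ℝ⁴`. -/
def liouville (x : E4) : E4 [⋀^Fin 1]→L[ℝ] ℝ := liouvilleCLM x

/-- `λ₀(x)(v) = ½ ω₀(x, v 0)`. -/
theorem liouville_apply (x : E4) (v : Fin 1 → E4) :
    liouville x v = 1 / 2 * stdSymplecticForm x (v 0) := by
  simp [liouville, liouvilleCLM]

/-- `λ₀` is `C^∞` (it is linear). -/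
theorem contDiff_liouville : ContDiff ℝ ∞ liouville := liouvilleCLM.contDiff

/-- `λ₀` is differentiable. -/
theorem differentiable_liouville : Differentiable ℝ liouville := liouvilleCLM.differentiable

/-- Every `v : Fin 2 → E4` is `![v 0, v 1]`. -/
theorem eq_vec2 (v : Fin 2 → E4) : v = ![v 0, v 1] := by
  ext i : 1; fin_cases i <;> rfl

/-- The exterior derivative of a differentiable `1`-form on two vectors. -/
theorem extDeriv_one_apply {α : E4 → E4 [⋀^Fin 1]→L[ℝ] ℝ} {x : E4} (h : DifferentiableAt ℝ α x)
    (v w : E4) :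
    extDeriv α x ![v, w] =
      fderiv ℝ (fun y => α y ![w]) x v - fderiv ℝ (fun y => α y ![v]) x w := by
  rw [extDeriv_apply h, Fin.sum_univ_two]
  have h0 : Fin.removeNth (0 : Fin 2) (![v, w] : Fin 2 → E4) = ![w] := by
    ext i : 1; fin_cases i; rfl
  have h1 : Fin.removeNth (1 : Fin 2) (![v, w] : Fin 2 → E4) = ![v] := by
    ext i : 1; fin_cases i; rfl
  simp [h0, h1, sub_eq_add_neg]

/-- `dλ₀ = ω₀`. -/
theorem extDeriv_liouville_apply (x v w : E4) :
    extDeriv liouville x ![v, w] = stdSymplecticForm v w := by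
  rw [extDeriv_one_apply (differentiable_liouville x)]
  have h1 : (fun y => liouville y ![w]) = fun y => (1 / 2 : ℝ) * stdSymplecticBilin y w := by
    funext y; rw [liouville_apply]; simp
  have h2 : (fun y => liouville y ![v]) = fun y => (1 / 2 : ℝ) * stdSymplecticBilin y v := by
    funext y; rw [liouville_apply]; simp
  rw [h1, h2]
  have e1 : fderiv ℝ (fun y => (1 / 2 : ℝ) * stdSymplecticBilin y w) x v
      = 1 / 2 * stdSymplecticForm v w := by
    have : (fun y => (1 / 2 : ℝ) * stdSymplecticBilin y w)
        = fun y => ((1 / 2 : ℝ) • (stdSymplecticBilin.flip w)) y := by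
      funext y; simp [smul_eq_mul]
    rw [this, ContinuousLinearMap.fderiv]
    simp
  have e2 : fderiv ℝ (fun y => (1 / 2 : ℝ) * stdSymplecticBilin y v) x w
      = 1 / 2 * stdSymplecticForm w v := by
    have : (fun y => (1 / 2 : ℝ) * stdSymplecticBilin y v)
        = fun y => ((1 / 2 : ℝ) • (stdSymplecticBilin.flip v)) y := by
      funext y; simp [smul_eq_mul]
    rw [this, ContinuousLinearMap.fderiv]
    simp
  rw [e1, e2, stdSymplecticForm_swap w v]
  ring

/-- `dλ₀ = ω₀` as alternating maps (`stdSymplecticAlt`). -/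
theorem extDeriv_liouville (x : E4) : extDeriv liouville x = stdSymplecticAlt := by
  ext v
  rw [eq_vec2 v, extDeriv_liouville_apply, stdSymplecticAlt_apply]


/-! ### Pull-back of the Liouville form and `d(Φ^*λ₀) = Φ^*ω₀` -/

/-- `Φ^*λ₀`. -/
def pullLiouville (Φ : E4 → E4) (x : E4) : E4 [⋀^Fin 1]→L[ℝ] ℝ :=
  (liouville (Φ x)).compContinuousLinearMap (fderiv ℝ Φ x)

/-- `(Φ^*λ₀)(x)(v) = ½ ω₀(Φ x, DΦ_x (v 0))`. -/
theorem pullLiouville_apply (Φ : E4 → E4) (x : E4) (v : Fin 1 → E4) :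
    pullLiouville Φ x v = 1 / 2 * stdSymplecticForm (Φ x) (fderiv ℝ Φ x (v 0)) := by
  simp [pullLiouville, ContinuousAlternatingMap.compContinuousLinearMap_apply, liouville_apply]

/-- `Φ^*λ₀` is `C^∞` for `C^∞` `Φ`. -/
theorem contDiff_pullLiouville {Φ : E4 → E4} (hΦ : ContDiff ℝ ∞ Φ) :
    ContDiff ℝ ∞ (pullLiouville Φ) := by
  have h1 : ContDiff ℝ ∞ (fun y => liouville (Φ y)) := contDiff_liouville.comp hΦ
  have h2 : ContDiff ℝ ∞ (fderiv ℝ Φ) := hΦ.fderiv_right (m := ∞) le_rfl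
  exact contDiff_iff_contDiffAt.2 fun x =>
    ContDiffAt.continuousAlternatingMapCompContinuousLinearMap h1.contDiffAt h2.contDiffAt

/-- `d(Φ^*λ₀)(x)(v, w) = ω₀(DΦ v, DΦ w)`. -/
theorem extDeriv_pullLiouville_apply {Φ : E4 → E4} (hΦ : ContDiff ℝ ∞ Φ) (x v w : E4) :
    extDeriv (pullLiouville Φ) x ![v, w] =
      stdSymplecticForm (fderiv ℝ Φ x v) (fderiv ℝ Φ x w) := by
  have h := extDeriv_pullback (differentiable_liouville (Φ x)) (hΦ.contDiffAt (x := x))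
    (r := ∞) (by rw [minSmoothness_of_isRCLikeNormedField]; exact WithTop.coe_le_coe.2 le_top)
  change extDeriv (fun x ↦ (liouville (Φ x)).compContinuousLinearMap (fderiv ℝ Φ x)) x ![v, w] = _
  rw [h, ContinuousAlternatingMap.compContinuousLinearMap_apply, extDeriv_liouville]
  have : (⇑(fderiv ℝ Φ x) ∘ ![v, w]) = ![fderiv ℝ Φ x v, fderiv ℝ Φ x w] := by
    ext i : 1; fin_cases i <;> rfl
  rw [this, stdSymplecticAlt_apply]

/-! ### Product rule for `d(χ • β)` on `1`-forms -/

/-- Product rule `d(χ β) = χ dβ + dχ ∧ β` for a function `χ` and a `1`-form `β`, on two vectors. -/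
theorem extDeriv_smul_one_apply {χ : E4 → ℝ} {β : E4 → E4 [⋀^Fin 1]→L[ℝ] ℝ} {x : E4}
    (hχ : DifferentiableAt ℝ χ x) (hβ : DifferentiableAt ℝ β x) (v w : E4) :
    extDeriv (fun y => χ y • β y) x ![v, w] =
      χ x * extDeriv β x ![v, w] +
        (fderiv ℝ χ x v * β x ![w] - fderiv ℝ χ x w * β x ![v]) := by
  rw [extDeriv_one_apply (α := fun y => χ y • β y) (hχ.smul hβ), extDeriv_one_apply hβ]
  have hβw : DifferentiableAt ℝ (fun y => β y ![w]) x :=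
    (ContinuousAlternatingMap.apply ℝ E4 ℝ ![w]).differentiableAt.comp x hβ
  have hβv : DifferentiableAt ℝ (fun y => β y ![v]) x :=
    (ContinuousAlternatingMap.apply ℝ E4 ℝ ![v]).differentiableAt.comp x hβ
  have e1 : (fun y => (χ y • β y) ![w]) = fun y => χ y * β y ![w] := by
    funext y; rfl
  have e2 : (fun y => (χ y • β y) ![v]) = fun y => χ y * β y ![v] := by
    funext y; rfl
  rw [e1, e2, fderiv_fun_mul hχ hβw, fderiv_fun_mul hχ hβv]
  simp only [add_apply, FunLike.coe_smul, Pi.smul_apply,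
    smul_eq_mul]
  ring


/-- Difference rule for `d` on `1`-forms, on two vectors. -/
theorem extDeriv_sub_one_apply {α γ : E4 → E4 [⋀^Fin 1]→L[ℝ] ℝ} {x : E4}
    (hα : DifferentiableAt ℝ α x) (hγ : DifferentiableAt ℝ γ x) (v w : E4) :
    extDeriv (fun y => α y - γ y) x ![v, w] = extDeriv α x ![v, w] - extDeriv γ x ![v, w] := by
  rw [extDeriv_one_apply (α := fun y => α y - γ y) (hα.sub hγ), extDeriv_one_apply hα,
    extDeriv_one_apply hγ]
  have hαw : DifferentiableAt ℝ (fun y => α y ![w]) x :=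
    (ContinuousAlternatingMap.apply ℝ E4 ℝ ![w]).differentiableAt.comp x hα
  have hαv : DifferentiableAt ℝ (fun y => α y ![v]) x :=
    (ContinuousAlternatingMap.apply ℝ E4 ℝ ![v]).differentiableAt.comp x hα
  have hγw : DifferentiableAt ℝ (fun y => γ y ![w]) x :=
    (ContinuousAlternatingMap.apply ℝ E4 ℝ ![w]).differentiableAt.comp x hγ
  have hγv : DifferentiableAt ℝ (fun y => γ y ![v]) x :=
    (ContinuousAlternatingMap.apply ℝ E4 ℝ ![v]).differentiableAt.comp x hγ
  have e1 : (fun y => (α y - γ y) ![w]) = fun y => α y ![w] - γ y ![w] := by funext y; rfl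
  have e2 : (fun y => (α y - γ y) ![v]) = fun y => α y ![v] - γ y ![v] := by funext y; rfl
  rw [e1, e2, fderiv_fun_sub hαw hγw, fderiv_fun_sub hαv hγv]
  simp only [sub_apply]
  ring

/-- The exterior derivative of a `C^∞` form is `C^∞`. -/
theorem contDiff_extDeriv' {k : ℕ} {η : E4 → E4 [⋀^Fin k]→L[ℝ] ℝ} (hη : ContDiff ℝ ∞ η) :
    ContDiff ℝ ∞ (extDeriv η) := by
  have : extDeriv η = fun x ↦
      ContinuousAlternatingMap.alternatizeUncurryFinCLM ℝ E4 ℝ (fderiv ℝ η x) := by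
    funext x; rfl
  rw [this]
  exact (ContinuousAlternatingMap.alternatizeUncurryFinCLM ℝ E4 ℝ).contDiff.comp
    (hη.fderiv_right (m := ∞) (by simp))

/-! ### The radial cut-off `χ_ρ` -/

/-- The argument `t_ρ(x) = ‖x‖² / (3ρ²) - 1/3` of the cut-off. -/
def cutArg (ρ : ℝ) (x : E4) : ℝ := 1 / (3 * ρ ^ 2) * ‖x‖ ^ 2 - 1 / 3

/-- The radial cut-off `χ_ρ = ψ ∘ t_ρ` with `ψ = Real.smoothTransition`: vanishes on `‖x‖ ≤ ρ`,
equals `1` on `‖x‖ ≥ 2ρ`. -/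
def cutoff (ρ : ℝ) (x : E4) : ℝ := Real.smoothTransition (cutArg ρ x)

/-- The cut-off argument is `C^∞`. -/
theorem contDiff_cutArg (ρ : ℝ) : ContDiff ℝ ∞ (cutArg ρ) :=
  (contDiff_const.mul (contDiff_norm_sq ℝ)).sub contDiff_const

/-- The cut-off is `C^∞`. -/
theorem contDiff_cutoff (ρ : ℝ) : ContDiff ℝ ∞ (cutoff ρ) :=
  Real.smoothTransition.contDiff.comp (contDiff_cutArg ρ)

/-- `t_ρ(x) ≤ 0` for `‖x‖ ≤ ρ`. -/
theorem cutArg_nonpos {ρ : ℝ} (hρ : 0 < ρ) {x : E4} (hx : ‖x‖ ≤ ρ) : cutArg ρ x ≤ 0 := by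
  unfold cutArg
  have h1 : ‖x‖ ^ 2 ≤ ρ ^ 2 := pow_le_pow_left₀ (norm_nonneg _) hx 2
  have hρ2 : 0 < ρ ^ 2 := by positivity
  rw [sub_nonpos, one_div_mul_eq_div, div_le_iff₀ (by positivity)]
  linarith

/-- `t_ρ(x) ≥ 1` for `‖x‖ ≥ 2ρ`. -/
theorem one_le_cutArg {ρ : ℝ} (hρ : 0 < ρ) {x : E4} (hx : 2 * ρ ≤ ‖x‖) : 1 ≤ cutArg ρ x := by
  unfold cutArg
  have h1 : (2 * ρ) ^ 2 ≤ ‖x‖ ^ 2 := pow_le_pow_left₀ (by positivity) hx 2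
  have hρ2 : 0 < ρ ^ 2 := by positivity
  rw [one_div_mul_eq_div, le_sub_iff_add_le, le_div_iff₀ (by positivity)]
  nlinarith

/-- `t_ρ(x) ∈ [0, 1]` on the annulus `ρ ≤ ‖x‖ ≤ 2ρ`. -/
theorem cutArg_mem_Icc {ρ : ℝ} (hρ : 0 < ρ) {x : E4} (h1 : ρ ≤ ‖x‖) (h2 : ‖x‖ ≤ 2 * ρ) :
    cutArg ρ x ∈ Icc (0 : ℝ) 1 := by
  unfold cutArg
  have hρ2 : 0 < ρ ^ 2 := by positivity
  have e1 : ρ ^ 2 ≤ ‖x‖ ^ 2 := pow_le_pow_left₀ hρ.le h1 2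
  have e2 : ‖x‖ ^ 2 ≤ (2 * ρ) ^ 2 := pow_le_pow_left₀ (norm_nonneg _) h2 2
  constructor
  · rw [sub_nonneg, one_div_mul_eq_div, le_div_iff₀ (by positivity)]
    linarith
  · rw [sub_le_iff_le_add, one_div_mul_eq_div, div_le_iff₀ (by positivity)]
    nlinarith

/-- `χ_ρ = 0` on `‖x‖ ≤ ρ`. -/
theorem cutoff_eq_zero {ρ : ℝ} (hρ : 0 < ρ) {x : E4} (hx : ‖x‖ ≤ ρ) : cutoff ρ x = 0 :=
  Real.smoothTransition.zero_of_nonpos (cutArg_nonpos hρ hx)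

/-- `χ_ρ = 1` on `‖x‖ ≥ 2ρ`. -/
theorem cutoff_eq_one {ρ : ℝ} (hρ : 0 < ρ) {x : E4} (hx : 2 * ρ ≤ ‖x‖) : cutoff ρ x = 1 :=
  Real.smoothTransition.one_of_one_le (one_le_cutArg hρ hx)

/-- `0 ≤ χ_ρ`. -/
theorem cutoff_nonneg (ρ : ℝ) (x : E4) : 0 ≤ cutoff ρ x := Real.smoothTransition.nonneg _

/-- `χ_ρ ≤ 1`. -/
theorem cutoff_le_one (ρ : ℝ) (x : E4) : cutoff ρ x ≤ 1 := Real.smoothTransition.le_one _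

/-- `χ_ρ` vanishes near every point of the open ball `‖x‖ < ρ`. -/
theorem cutoff_eventuallyEq_zero {ρ : ℝ} (hρ : 0 < ρ) {x : E4} (hx : ‖x‖ < ρ) :
    cutoff ρ =ᶠ[𝓝 x] fun _ => 0 := by
  have ho : IsOpen {y : E4 | ‖y‖ < ρ} := isOpen_lt continuous_norm continuous_const
  filter_upwards [ho.mem_nhds hx] with y hy
  exact cutoff_eq_zero hρ (le_of_lt hy)

/-- `χ_ρ = 1` near every point with `‖x‖ > 2ρ`. -/
theorem cutoff_eventuallyEq_one {ρ : ℝ} (hρ : 0 < ρ) {x : E4} (hx : 2 * ρ < ‖x‖) :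
    cutoff ρ =ᶠ[𝓝 x] fun _ => 1 := by
  have ho : IsOpen {y : E4 | 2 * ρ < ‖y‖} := isOpen_lt continuous_const continuous_norm
  filter_upwards [ho.mem_nhds hx] with y hy
  exact cutoff_eq_one hρ (le_of_lt hy)

/-- Derivative of the cut-off argument: `dt_ρ(x) = (2/(3ρ²)) ⟪x, ·⟫`. -/
theorem hasFDerivAt_cutArg (ρ : ℝ) (x : E4) :
    HasFDerivAt (cutArg ρ) ((1 / (3 * ρ ^ 2)) • (2 • innerSL ℝ x)) x :=
  ((hasStrictFDerivAt_norm_sq x).hasFDerivAt.const_mul (1 / (3 * ρ ^ 2))).sub_const (1 / 3)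

/-- Chain rule for the cut-off. -/
theorem hasFDerivAt_cutoff (ρ : ℝ) (x : E4) :
    HasFDerivAt (cutoff ρ) (deriv Real.smoothTransition (cutArg ρ x) •
      ((1 / (3 * ρ ^ 2)) • (2 • innerSL ℝ x))) x := by
  have hd : Differentiable ℝ Real.smoothTransition :=
    (Real.smoothTransition.contDiff (n := 1)).differentiable (by simp)
  have hψ : HasDerivAt Real.smoothTransition (deriv Real.smoothTransition (cutArg ρ x))
      (cutArg ρ x) := (hd _).hasDerivAt
  exact hψ.comp_hasFDerivAt x (hasFDerivAt_cutArg ρ x)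

/-- A bound for `|ψ'|` on `[0, 1]`. -/
theorem exists_bound_deriv_smoothTransition :
    ∃ K : ℝ, 0 ≤ K ∧ ∀ t ∈ Icc (0 : ℝ) 1, |deriv Real.smoothTransition t| ≤ K := by
  have hc : Continuous (deriv Real.smoothTransition) :=
    (Real.smoothTransition.contDiff (n := 1)).continuous_deriv le_rfl
  obtain ⟨K, hK⟩ := isCompact_Icc.exists_bound_of_continuousOn hc.continuousOn
  refine ⟨max K 0, le_max_right _ _, fun t ht => ?_⟩
  have := hK t ht
  rw [Real.norm_eq_abs] at this
  exact this.trans (le_max_left _ _)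

/-- Gradient bound for the cut-off on the annulus `ρ ≤ ‖x‖ ≤ 2ρ`: `|dχ_ρ(x) v| ≤ (4K/3ρ) ‖v‖`. -/
theorem abs_fderiv_cutoff_le {K : ℝ} (hK0 : 0 ≤ K)
    (hK : ∀ t ∈ Icc (0 : ℝ) 1, |deriv Real.smoothTransition t| ≤ K)
    {ρ : ℝ} (hρ : 0 < ρ) {x : E4} (h1 : ρ ≤ ‖x‖) (h2 : ‖x‖ ≤ 2 * ρ) (v : E4) :
    |fderiv ℝ (cutoff ρ) x v| ≤ 4 * K / (3 * ρ) * ‖v‖ := by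
  rw [(hasFDerivAt_cutoff ρ x).fderiv]
  simp only [smul_apply, innerSL_apply_apply, smul_eq_mul, nsmul_eq_mul, Nat.cast_ofNat]
  have ht := hK _ (cutArg_mem_Icc hρ h1 h2)
  have hin : |⟪x, v⟫_ℝ| ≤ ‖x‖ * ‖v‖ := abs_real_inner_le_norm x v
  have hρ2 : 0 < ρ ^ 2 := by positivity
  rw [abs_mul, abs_mul, abs_mul, abs_of_pos (by positivity : (0 : ℝ) < 1 / (3 * ρ ^ 2)),
    abs_of_pos (by norm_num : (0 : ℝ) < 2)]
  calc |deriv Real.smoothTransition (cutArg ρ x)| * (1 / (3 * ρ ^ 2) * (2 * |⟪x, v⟫_ℝ|))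
      ≤ K * (1 / (3 * ρ ^ 2) * (2 * (‖x‖ * ‖v‖))) := by
        apply mul_le_mul ht _ (by positivity) hK0
        apply mul_le_mul_of_nonneg_left _ (by positivity)
        linarith
    _ ≤ K * (1 / (3 * ρ ^ 2) * (2 * ((2 * ρ) * ‖v‖))) := by
        apply mul_le_mul_of_nonneg_left _ hK0
        apply mul_le_mul_of_nonneg_left _ (by positivity)
        apply mul_le_mul_of_nonneg_left _ (by norm_num)
        exact mul_le_mul_of_nonneg_right h2 (norm_nonneg _)
    _ = 4 * K / (3 * ρ) * ‖v‖ := by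
        field_simp
        ring

end Summit.SmoothPoincare4.SmoothPoincare4.Cruxes.TameOrBrodyR4.Sketch.Gluing
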